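import Mathlib
import HarnessLib
import Literature.Analysis.FunctionSpaces.BesselJ
import Literature.Analysis.FunctionSpaces.BesselJAnalyticProofs
import Literature.Analysis.SpecialFunctions.LegendrePolynomials
import Literature.Analysis.SpecialFunctions.LegendreTripleProduct
import Literature.Analysis.SpecialFunctions.SphericalBesselFunctions

/-!
# Fourier coefficients by Chebyshev and Legendre expansions (Davis–Rabinowitz 1984, Sect. 2.10.5)

Davis–Rabinowitz, *Methods of Numerical Integration* (2nd ed., 1984), Sect. 2.10.5 "Use of Tschebyscheff and
Legendre Expansions" (Piessens–Poleunis; Bakhvalov–Vasil'eva, Littlewood–Zakian, Piessens): for the Fourier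
coefficients `S(m) = ∫_{-1}^{1} f(x) sin mx dx`, `C(m) = ∫_{-1}^{1} f(x) cos mx dx` use

* (2.10.5.1) `∫_{-1}^{1} sin mx T_n(x) (1-x²)^{-1/2} dx = 0` (`n = 2k`), `= (-1)^k π J_n(m)` (`n = 2k+1`);
* (2.10.5.2) `∫_{-1}^{1} cos mx T_n(x) (1-x²)^{-1/2} dx = (-1)^k π J_n(m)` (`n = 2k`), `= 0` (`n = 2k+1`);

so that an expansion `(1-x²)^{1/2} f(x) = Σ C_n T_n(x)` (2.10.5.3) gives
`S(m) = π Σ_k C_{2k+1} (-1)^k J_{2k+1}(m)` (2.10.5.4), `C(m) = π Σ_k C_{2k} (-1)^k J_{2k}(m)` (2.10.5.5), with the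
`C_n` approximated from the Chebyshev coefficients `α_n` of `f` by (2.10.5.6)–(2.10.5.7); alternatively the Legendre
expansion `f = Σ c_k P_k`, `c_k = (2k+1)/2 ∫ f P_k` (2.10.5.10) with the closed form
`∫_{-1}^{1} e^{imx} P_k(x) dx = i^k (2π/m)^{1/2} J_{k+1/2}(m)` (2.10.5.11) and the expansions (2.10.5.12)–(2.10.5.13).

What is formalised here, over the tree's `Literature.Analysis.FunctionSpaces.besselJ` (integer order),
`Literature.Analysis.SpecialFunctions.legendre` / `sphBesselJ` / `gegenbauerIntegral`, and Mathlib's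
`Polynomial.Chebyshev.T`:

* `S(m)`, `C(m)` (`fourierSinCoeff`, `fourierCosCoeff`) and the Chebyshev moments of (2.10.5.1)–(2.10.5.2)
  (`chebSinMoment`, `chebCosMoment`);
* the VANISHING halves of (2.10.5.1)–(2.10.5.2) PROVED by parity (`chebSinMoment_two_mul`,
  `chebCosMoment_two_mul_add_one`, from `T_n(-x) = (-1)^n T_n(x)` and `∫_{-1}^{1}` of an odd function `= 0`,
  `intervalIntegral_neg_one_one_eq_zero_of_odd`); the Bessel halves as NAMED FACTS (`ChebSinMomentBessel`,
  `ChebCosMomentBessel`), BOTH PROVED in the appended section (`ChebSinMomentBessel_holds`,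
  `ChebCosMomentBessel_holds`: substitution `x = cos θ` and Bessel's integral);
* the series (2.10.5.4)–(2.10.5.5) and the coefficient approximations (2.10.5.6)–(2.10.5.7) as definitions
  (`piessensSinSeries`, `piessensCosSeries`, `chebCoeffApproxEven`, `chebCoeffApproxOdd`) and the expansion
  statements as NAMED FACTS under absolute summability of the `C_n` (`PiessensPoleunisSin`, `PiessensPoleunisCos`),
  BOTH PROVED at the end of the file (`PiessensPoleunisSin_holds`, `PiessensPoleunisCos_holds`, termwise integration);
* the Legendre coefficients (2.10.5.10) (`legendreFourierCoeff`; on polynomials it is the tree's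
  `Literature.Analysis.SpecialFunctions.legendreCoeff`, `legendreFourierCoeff_eval`);
* **(2.10.5.11) PROVED in the tree's normalisation**: its left side `∫_{-1}^{1} e^{imx} P_k(x) dx` IS the tree's
  Gegenbauer integral `Literature.Analysis.SpecialFunctions.gegenbauerIntegral k m` (A&S 10.1.14), by which the
  tree DEFINES the spherical Bessel function `j_k = sphBesselJ k` and which it identifies with
  `√(π/(2m)) J_{k+½}(m)` (`ofReal_sphBesselJ_eq_sqrt_mul_besselJC`); so (2.10.5.11) reads
  `gegenbauerIntegral k m = 2 iᵏ j_k(m)` (`gegenbauerIntegral_eq_sphBesselJ`), and taking real and imaginary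
  parts (`integral_cos_mul_legendre_eq_re`, `integral_sin_mul_legendre_eq_im`) gives the PROVED moment formulas
  behind (2.10.5.12)–(2.10.5.13): `∫ cos mx P_{2j} = 2(-1)ʲ j_{2j}(m)`, `∫ sin mx P_{2j+1} = 2(-1)ʲ j_{2j+1}(m)`,
  `∫ sin mx P_{2j} = ∫ cos mx P_{2j+1} = 0` (`integral_cos_mul_legendre_two_mul`,
  `integral_sin_mul_legendre_two_mul_add_one`, `integral_sin_mul_legendre_two_mul`,
  `integral_cos_mul_legendre_two_mul_add_one`; `k = 0`: `2 sin m / m`, `integral_cos_mul_legendre_zero`), the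
  single-term cases of (2.10.5.12)–(2.10.5.13) (`fourierSinCoeff_legendre_two_mul_add_one`,
  `fourierCosCoeff_legendre_two_mul`), and the full expansions as NAMED FACTS under absolute summability of the
  `c_k` (`BakhvalovVasilevaSin`, `BakhvalovVasilevaCos`, series `bakhvalovSinSeries`, `bakhvalovCosSeries`), BOTH
  PROVED at the end of the file (`BakhvalovVasilevaSin_holds`, `BakhvalovVasilevaCos_holds`).

Not formalised: the modified-Bessel variants (2.10.5.8)–(2.10.5.9), error bounds (Smith, Patterson). (The Bessel
evaluations (2.10.5.1)–(2.10.5.2) are PROVED at the end of the file from the tree's Bessel integral.)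
-/

open MeasureTheory Set intervalIntegral Polynomial

namespace Literature.Analysis.Quadrature

open Literature.Analysis.FunctionSpaces (besselJ)
open Literature.Analysis.SpecialFunctions (legendre legendre_zero gegenbauerIntegral gegenbauerKernel sphBesselJ
  ofReal_sphBesselJ intervalIntegrable_gegenbauerKernel sphBesselJ_zero_left)
open Complex (I ofReal_re ofReal_im I_sq)

/-! ## The Fourier coefficients and the Chebyshev moments -/

/-- `S(m) = ∫_{-1}^{1} f(x) sin mx dx`. [cite: DavisRabinowitz1984, Sect. 2.10.5 (2.10.5.4)] -/
noncomputable def fourierSinCoeff (f : ℝ → ℝ) (m : ℝ) : ℝ := ∫ x in (-1 : ℝ)..1, f x * Real.sin (m * x)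

/-- `C(m) = ∫_{-1}^{1} f(x) cos mx dx`. [cite: DavisRabinowitz1984, Sect. 2.10.5 (2.10.5.5)] -/
noncomputable def fourierCosCoeff (f : ℝ → ℝ) (m : ℝ) : ℝ := ∫ x in (-1 : ℝ)..1, f x * Real.cos (m * x)

/-- The moment `∫_{-1}^{1} sin mx T_n(x) (1-x²)^{-1/2} dx` of (2.10.5.1). [cite: DavisRabinowitz1984, Sect. 2.10.5 (2.10.5.1)] -/
noncomputable def chebSinMoment (m : ℝ) (n : ℕ) : ℝ :=
  ∫ x in (-1 : ℝ)..1, Real.sin (m * x) * (Chebyshev.T ℝ n).eval x / Real.sqrt (1 - x ^ 2)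

/-- The moment `∫_{-1}^{1} cos mx T_n(x) (1-x²)^{-1/2} dx` of (2.10.5.2). [cite: DavisRabinowitz1984, Sect. 2.10.5 (2.10.5.2)] -/
noncomputable def chebCosMoment (m : ℝ) (n : ℕ) : ℝ :=
  ∫ x in (-1 : ℝ)..1, Real.cos (m * x) * (Chebyshev.T ℝ n).eval x / Real.sqrt (1 - x ^ 2)

/-- An odd function integrates to zero over `[-1, 1]`. [cite: DavisRabinowitz1984, Sect. 2.10.5 (2.10.5.1)] -/
theorem intervalIntegral_neg_one_one_eq_zero_of_odd {g : ℝ → ℝ} (hg : ∀ x, g (-x) = -g x) :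
    ∫ x in (-1 : ℝ)..1, g x = 0 := by
  have h1 : ∫ x in (-1 : ℝ)..1, g (-x) = ∫ x in (-1 : ℝ)..1, g x := by
    rw [intervalIntegral.integral_comp_neg]; norm_num
  have h2 : ∫ x in (-1 : ℝ)..1, g (-x) = -∫ x in (-1 : ℝ)..1, g x := by
    simp only [hg, intervalIntegral.integral_neg]
  linarith

/-- **(2.10.5.1), even case:** `∫_{-1}^{1} sin mx T_{2k}(x) (1-x²)^{-1/2} dx = 0` (the integrand is odd).
[cite: DavisRabinowitz1984, Sect. 2.10.5 (2.10.5.1)] -/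
theorem chebSinMoment_two_mul (m : ℝ) (k : ℕ) : chebSinMoment m (2 * k) = 0 := by
  unfold chebSinMoment
  apply intervalIntegral_neg_one_one_eq_zero_of_odd
  intro x
  have hT : (Chebyshev.T ℝ ((2 * k : ℕ) : ℤ)).eval (-x) = (Chebyshev.T ℝ ((2 * k : ℕ) : ℤ)).eval x := by
    rw [Chebyshev.T_eval_neg, Int.negOnePow_even _]
    · simp
    · exact ⟨k, by push_cast; ring⟩
  rw [hT, show (-x) ^ 2 = x ^ 2 by ring]
  simp only [mul_neg, Real.sin_neg, neg_mul, neg_div]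

/-- **(2.10.5.2), odd case:** `∫_{-1}^{1} cos mx T_{2k+1}(x) (1-x²)^{-1/2} dx = 0` (the integrand is odd).
[cite: DavisRabinowitz1984, Sect. 2.10.5 (2.10.5.2)] -/
theorem chebCosMoment_two_mul_add_one (m : ℝ) (k : ℕ) : chebCosMoment m (2 * k + 1) = 0 := by
  unfold chebCosMoment
  apply intervalIntegral_neg_one_one_eq_zero_of_odd
  intro x
  have hT : (Chebyshev.T ℝ ((2 * k + 1 : ℕ) : ℤ)).eval (-x) = -(Chebyshev.T ℝ ((2 * k + 1 : ℕ) : ℤ)).eval x := by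
    rw [Chebyshev.T_eval_neg, Int.negOnePow_odd _]
    · simp
    · exact ⟨k, by push_cast; ring⟩
  rw [hT, show (-x) ^ 2 = x ^ 2 by ring]
  simp only [mul_neg, Real.cos_neg, neg_div]

/-- NAMED FACT **(2.10.5.1), odd case:** `∫_{-1}^{1} sin mx T_{2k+1}(x) (1-x²)^{-1/2} dx = (-1)^k π J_{2k+1}(m)`;
proved at the end of the file (`ChebSinMomentBessel_holds`). [cite: DavisRabinowitz1984, Sect. 2.10.5 (2.10.5.1)] -/
def ChebSinMomentBessel (m : ℝ) (k : ℕ) : Prop :=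
  chebSinMoment m (2 * k + 1) = (-1) ^ k * Real.pi * besselJ (2 * k + 1) m

/-- NAMED FACT **(2.10.5.2), even case:** `∫_{-1}^{1} cos mx T_{2k}(x) (1-x²)^{-1/2} dx = (-1)^k π J_{2k}(m)`;
proved at the end of the file (`ChebCosMomentBessel_holds`). [cite: DavisRabinowitz1984, Sect. 2.10.5 (2.10.5.2)] -/
def ChebCosMomentBessel (m : ℝ) (k : ℕ) : Prop :=
  chebCosMoment m (2 * k) = (-1) ^ k * Real.pi * besselJ (2 * k) m

/-! ## The Piessens–Poleunis series (2.10.5.3)–(2.10.5.7) -/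

/-- The series of (2.10.5.4): `π Σ_k C_{2k+1} (-1)^k J_{2k+1}(m)`. [cite: DavisRabinowitz1984, Sect. 2.10.5 (2.10.5.4)] -/
noncomputable def piessensSinSeries (C : ℕ → ℝ) (m : ℝ) : ℝ :=
  Real.pi * ∑' k : ℕ, C (2 * k + 1) * (-1) ^ k * besselJ (2 * k + 1) m

/-- The series of (2.10.5.5): `π Σ_k C_{2k} (-1)^k J_{2k}(m)`. [cite: DavisRabinowitz1984, Sect. 2.10.5 (2.10.5.5)] -/
noncomputable def piessensCosSeries (C : ℕ → ℝ) (m : ℝ) : ℝ :=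
  Real.pi * ∑' k : ℕ, C (2 * k) * (-1) ^ k * besselJ (2 * k) m

/-- NAMED FACT **(2.10.5.3) ⇒ (2.10.5.4)**: if `(1-x²)^{1/2} f(x) = Σ C_n T_n(x)` on `(-1, 1)` with `Σ |C_n| < ∞`
(so the expansion converges uniformly, `|T_n| ≤ 1`), then `S(m) = π Σ_k C_{2k+1} (-1)^k J_{2k+1}(m)`.
Proved at the end of the file (`PiessensPoleunisSin_holds`).
[cite: DavisRabinowitz1984, Sect. 2.10.5 (2.10.5.4)] -/
def PiessensPoleunisSin (f : ℝ → ℝ) (C : ℕ → ℝ) (m : ℝ) : Prop :=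
  Summable (fun n => |C n|) →
    (∀ x ∈ Ioo (-1 : ℝ) 1, HasSum (fun n => C n * (Chebyshev.T ℝ n).eval x) (Real.sqrt (1 - x ^ 2) * f x)) →
      fourierSinCoeff f m = piessensSinSeries C m

/-- NAMED FACT **(2.10.5.3) ⇒ (2.10.5.5)**: under the same hypotheses, `C(m) = π Σ_k C_{2k} (-1)^k J_{2k}(m)`.
Proved at the end of the file (`PiessensPoleunisCos_holds`).
[cite: DavisRabinowitz1984, Sect. 2.10.5 (2.10.5.5)] -/
def PiessensPoleunisCos (f : ℝ → ℝ) (C : ℕ → ℝ) (m : ℝ) : Prop :=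
  Summable (fun n => |C n|) →
    (∀ x ∈ Ioo (-1 : ℝ) 1, HasSum (fun n => C n * (Chebyshev.T ℝ n).eval x) (Real.sqrt (1 - x ^ 2) * f x)) →
      fourierCosCoeff f m = piessensCosSeries C m

/-- The approximation (2.10.5.6) of `C_{2k}` from the Chebyshev coefficients `α_n` of `f` ((2.13.1.10)):
`C_{2k} ≈ -(2/π) Σ_{i=0}^{[N/2]} α_{2i} [1/((2i+2k)²-1) + 1/((2i-2k)²-1)]`.
[cite: DavisRabinowitz1984, Sect. 2.10.5 (2.10.5.6)] -/
noncomputable def chebCoeffApproxEven (α : ℕ → ℝ) (N k : ℕ) : ℝ :=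
  -(2 / Real.pi) * ∑ i ∈ Finset.range (N / 2 + 1),
    α (2 * i) * (1 / ((2 * (i : ℝ) + 2 * k) ^ 2 - 1) + 1 / ((2 * (i : ℝ) - 2 * k) ^ 2 - 1))

/-- The approximation (2.10.5.7) of `C_{2k+1}`:
`C_{2k+1} ≈ -(2/π) Σ_{i=0}^{[(N-1)/2]} α_{2i+1} [1/((2i+2k+2)²-1) + 1/((2i-2k)²-1)]`.
[cite: DavisRabinowitz1984, Sect. 2.10.5 (2.10.5.7)] -/
noncomputable def chebCoeffApproxOdd (α : ℕ → ℝ) (N k : ℕ) : ℝ :=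
  -(2 / Real.pi) * ∑ i ∈ Finset.range ((N - 1) / 2 + 1),
    α (2 * i + 1) * (1 / ((2 * (i : ℝ) + 2 * k + 2) ^ 2 - 1) + 1 / ((2 * (i : ℝ) - 2 * k) ^ 2 - 1))

/-! ## The Legendre expansion (2.10.5.10)–(2.10.5.13), over the tree's spherical Bessel functions -/

/-- The Legendre coefficient `c_k = (2k+1)/2 ∫_{-1}^{1} f(x) P_k(x) dx` of (2.10.5.10), over the tree's `legendre`.
[cite: DavisRabinowitz1984, Sect. 2.10.5 (2.10.5.10)] -/
noncomputable def legendreFourierCoeff (f : ℝ → ℝ) (k : ℕ) : ℝ :=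
  (2 * k + 1) / 2 * ∫ x in (-1 : ℝ)..1, f x * (legendre k).eval x

/-- On polynomials the coefficient (2.10.5.10) is the tree's Legendre coefficient functional
`Literature.Analysis.SpecialFunctions.legendreCoeff` (Arfken (12.50)); this file's `legendreFourierCoeff` is its
extension to arbitrary integrands `f`. [cite: DavisRabinowitz1984, Sect. 2.10.5 (2.10.5.10)] -/
theorem legendreFourierCoeff_eval (R : ℝ[X]) (k : ℕ) :
    legendreFourierCoeff (fun x => R.eval x) k = Literature.Analysis.SpecialFunctions.legendreCoeff R k := rfl

/-- **(2.10.5.11)** in the tree's normalisation: `∫_{-1}^{1} e^{imx} P_k(x) dx = 2 iᵏ j_k(m)`.  The left side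
is the tree's Gegenbauer integral `gegenbauerIntegral k m` (A&S 10.1.14) and `j_k = sphBesselJ k` is the
tree's spherical Bessel function, DEFINED by this integral and identified with `√(π/(2m)) J_{k+½}(m)` for
`m > 0` in `Literature.Analysis.SpecialFunctions.ofReal_sphBesselJ_eq_sqrt_mul_besselJC`; hence
`2 iᵏ j_k(m) = iᵏ (2π/m)^{1/2} J_{k+1/2}(m)`, the right side printed in (2.10.5.11).
[cite: DavisRabinowitz1984, Sect. 2.10.5 (2.10.5.11)] [cite: AbramowitzStegun1964, 10.1.1, 10.1.14] -/
theorem gegenbauerIntegral_eq_sphBesselJ (k : ℕ) (m : ℝ) :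
    gegenbauerIntegral k m = 2 * I ^ k * (sphBesselJ k m : ℂ) := by
  rw [ofReal_sphBesselJ]
  have h : I ^ k * (-I) ^ k = 1 := by
    rw [← mul_pow]
    simp
  calc gegenbauerIntegral k m = I ^ k * (-I) ^ k * gegenbauerIntegral k m := by rw [h, one_mul]
    _ = 2 * I ^ k * ((-I) ^ k / 2 * gegenbauerIntegral k m) := by ring

/-- The cosine Legendre moment is the real part of Gegenbauer's integral:
`∫_{-1}^{1} cos mx P_k(x) dx = Re ∫_{-1}^{1} e^{imx} P_k(x) dx`. [cite: DavisRabinowitz1984, Sect. 2.10.5 (2.10.5.11)] -/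
theorem integral_cos_mul_legendre_eq_re (k : ℕ) (m : ℝ) :
    ∫ x in (-1 : ℝ)..1, Real.cos (m * x) * (legendre k).eval x = (gegenbauerIntegral k m).re := by
  have h := Complex.reCLM.intervalIntegral_comp_comm (intervalIntegrable_gegenbauerKernel k m (-1) 1)
  simp only [Complex.reCLM_apply] at h
  rw [gegenbauerIntegral, ← h]
  refine intervalIntegral.integral_congr fun x _ => ?_
  simp only [gegenbauerKernel]
  rw [show I * (m : ℂ) * (x : ℂ) = ((m * x : ℝ) : ℂ) * I by push_cast; ring]
  simp only [Complex.mul_re, ofReal_re, ofReal_im, mul_zero, sub_zero, Complex.exp_ofReal_mul_I_re]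

/-- The sine Legendre moment is the imaginary part of Gegenbauer's integral:
`∫_{-1}^{1} sin mx P_k(x) dx = Im ∫_{-1}^{1} e^{imx} P_k(x) dx`. [cite: DavisRabinowitz1984, Sect. 2.10.5 (2.10.5.11)] -/
theorem integral_sin_mul_legendre_eq_im (k : ℕ) (m : ℝ) :
    ∫ x in (-1 : ℝ)..1, Real.sin (m * x) * (legendre k).eval x = (gegenbauerIntegral k m).im := by
  have h := Complex.imCLM.intervalIntegral_comp_comm (intervalIntegrable_gegenbauerKernel k m (-1) 1)
  simp only [Complex.imCLM_apply] at h
  rw [gegenbauerIntegral, ← h]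
  refine intervalIntegral.integral_congr fun x _ => ?_
  simp only [gegenbauerKernel]
  rw [show I * (m : ℂ) * (x : ℂ) = ((m * x : ℝ) : ℂ) * I by push_cast; ring]
  simp only [Complex.mul_im, ofReal_re, ofReal_im, mul_zero, zero_add, Complex.exp_ofReal_mul_I_im]

/-- **(2.10.5.11) ⇒ the even terms of (2.10.5.13):** `∫_{-1}^{1} cos mx P_{2j}(x) dx = 2 (-1)ʲ j_{2j}(m)`
(`= (2π/m)^{1/2} (-1)ʲ J_{2j+1/2}(m)`). [cite: DavisRabinowitz1984, Sect. 2.10.5 (2.10.5.13)] -/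
theorem integral_cos_mul_legendre_two_mul (j : ℕ) (m : ℝ) :
    ∫ x in (-1 : ℝ)..1, Real.cos (m * x) * (legendre (2 * j)).eval x = 2 * (-1) ^ j * sphBesselJ (2 * j) m := by
  have h : gegenbauerIntegral (2 * j) m = ((2 * (-1) ^ j * sphBesselJ (2 * j) m : ℝ) : ℂ) := by
    rw [gegenbauerIntegral_eq_sphBesselJ, pow_mul, I_sq]
    push_cast
    ring
  rw [integral_cos_mul_legendre_eq_re, h, ofReal_re]

/-- **(2.10.5.11) ⇒ no even terms in (2.10.5.12):** `∫_{-1}^{1} sin mx P_{2j}(x) dx = 0`.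
[cite: DavisRabinowitz1984, Sect. 2.10.5 (2.10.5.12)] -/
theorem integral_sin_mul_legendre_two_mul (j : ℕ) (m : ℝ) :
    ∫ x in (-1 : ℝ)..1, Real.sin (m * x) * (legendre (2 * j)).eval x = 0 := by
  have h : gegenbauerIntegral (2 * j) m = ((2 * (-1) ^ j * sphBesselJ (2 * j) m : ℝ) : ℂ) := by
    rw [gegenbauerIntegral_eq_sphBesselJ, pow_mul, I_sq]
    push_cast
    ring
  rw [integral_sin_mul_legendre_eq_im, h, ofReal_im]

/-- **(2.10.5.11) ⇒ the odd terms of (2.10.5.12):** `∫_{-1}^{1} sin mx P_{2j+1}(x) dx = 2 (-1)ʲ j_{2j+1}(m)`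
(`= (2π/m)^{1/2} (-1)ʲ J_{2j+3/2}(m)`). [cite: DavisRabinowitz1984, Sect. 2.10.5 (2.10.5.12)] -/
theorem integral_sin_mul_legendre_two_mul_add_one (j : ℕ) (m : ℝ) :
    ∫ x in (-1 : ℝ)..1, Real.sin (m * x) * (legendre (2 * j + 1)).eval x =
      2 * (-1) ^ j * sphBesselJ (2 * j + 1) m := by
  have h : gegenbauerIntegral (2 * j + 1) m = ((2 * (-1) ^ j * sphBesselJ (2 * j + 1) m : ℝ) : ℂ) * I := by
    rw [gegenbauerIntegral_eq_sphBesselJ, pow_succ, pow_mul, I_sq]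
    push_cast
    ring
  rw [integral_sin_mul_legendre_eq_im, h]
  simp only [Complex.mul_im, Complex.I_re, Complex.I_im, ofReal_re, ofReal_im, mul_one, mul_zero, add_zero]

/-- **(2.10.5.11) ⇒ no odd terms in (2.10.5.13):** `∫_{-1}^{1} cos mx P_{2j+1}(x) dx = 0`.
[cite: DavisRabinowitz1984, Sect. 2.10.5 (2.10.5.13)] -/
theorem integral_cos_mul_legendre_two_mul_add_one (j : ℕ) (m : ℝ) :
    ∫ x in (-1 : ℝ)..1, Real.cos (m * x) * (legendre (2 * j + 1)).eval x = 0 := by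
  have h : gegenbauerIntegral (2 * j + 1) m = ((2 * (-1) ^ j * sphBesselJ (2 * j + 1) m : ℝ) : ℂ) * I := by
    rw [gegenbauerIntegral_eq_sphBesselJ, pow_succ, pow_mul, I_sq]
    push_cast
    ring
  rw [integral_cos_mul_legendre_eq_re, h]
  simp only [Complex.mul_re, Complex.I_re, Complex.I_im, ofReal_re, ofReal_im, mul_one, mul_zero, sub_zero]

/-- The `k = 0` term: `∫_{-1}^{1} cos mx dx = 2 sin m / m = 2 j_0(m)` (`m ≠ 0`; `j_0 = sin x / x`,
`sphBesselJ_zero_left`). [cite: DavisRabinowitz1984, Sect. 2.10.5 (2.10.5.13)] -/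
theorem integral_cos_mul_legendre_zero {m : ℝ} (hm : m ≠ 0) :
    ∫ x in (-1 : ℝ)..1, Real.cos (m * x) * (legendre 0).eval x = 2 * Real.sin m / m := by
  have h := integral_cos_mul_legendre_two_mul 0 m
  rw [Nat.mul_zero, sphBesselJ_zero_left hm] at h
  rw [h]
  ring

/-- The series of (2.10.5.12) in the tree's normalisation: `Σ_j 2 (-1)ʲ c_{2j+1} j_{2j+1}(m)`
(`= (2π/m)^{1/2} Σ_j (-1)ʲ c_{2j+1} J_{2j+3/2}(m)`). [cite: DavisRabinowitz1984, Sect. 2.10.5 (2.10.5.12)] -/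
noncomputable def bakhvalovSinSeries (c : ℕ → ℝ) (m : ℝ) : ℝ :=
  ∑' j : ℕ, 2 * (-1) ^ j * c (2 * j + 1) * sphBesselJ (2 * j + 1) m

/-- The series of (2.10.5.13) in the tree's normalisation: `Σ_j 2 (-1)ʲ c_{2j} j_{2j}(m)`
(`= (2π/m)^{1/2} Σ_j (-1)ʲ c_{2j} J_{2j+1/2}(m)`). [cite: DavisRabinowitz1984, Sect. 2.10.5 (2.10.5.13)] -/
noncomputable def bakhvalovCosSeries (c : ℕ → ℝ) (m : ℝ) : ℝ :=
  ∑' j : ℕ, 2 * (-1) ^ j * c (2 * j) * sphBesselJ (2 * j) m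

/-- NAMED FACT **(2.10.5.12)**: if `f = Σ c_k P_k` on `(-1, 1)` with `Σ |c_k| < ∞` (uniform convergence, `|P_k| ≤ 1`),
then `S(m) = (2π/m)^{1/2} Σ_j (-1)ʲ c_{2j+1} J_{2j+3/2}(m) = Σ_j 2 (-1)ʲ c_{2j+1} j_{2j+1}(m)`.
Proved at the end of the file (`BakhvalovVasilevaSin_holds`).
[cite: DavisRabinowitz1984, Sect. 2.10.5 (2.10.5.12)] -/
def BakhvalovVasilevaSin (f : ℝ → ℝ) (c : ℕ → ℝ) (m : ℝ) : Prop :=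
  Summable (fun k => |c k|) →
    (∀ x ∈ Ioo (-1 : ℝ) 1, HasSum (fun k => c k * (legendre k).eval x) (f x)) →
      fourierSinCoeff f m = bakhvalovSinSeries c m

/-- NAMED FACT **(2.10.5.13)**: under the same hypotheses,
`C(m) = (2π/m)^{1/2} Σ_j (-1)ʲ c_{2j} J_{2j+1/2}(m) = Σ_j 2 (-1)ʲ c_{2j} j_{2j}(m)`.
Proved at the end of the file (`BakhvalovVasilevaCos_holds`).
[cite: DavisRabinowitz1984, Sect. 2.10.5 (2.10.5.13)] -/
def BakhvalovVasilevaCos (f : ℝ → ℝ) (c : ℕ → ℝ) (m : ℝ) : Prop :=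
  Summable (fun k => |c k|) →
    (∀ x ∈ Ioo (-1 : ℝ) 1, HasSum (fun k => c k * (legendre k).eval x) (f x)) →
      fourierCosCoeff f m = bakhvalovCosSeries c m

/-- The single-term case of (2.10.5.13), PROVED: for `f = c P_{2j}`, `C(m) = 2 (-1)ʲ c j_{2j}(m)`.
[cite: DavisRabinowitz1984, Sect. 2.10.5 (2.10.5.13)] -/
theorem fourierCosCoeff_legendre_two_mul (c : ℝ) (j : ℕ) (m : ℝ) :
    fourierCosCoeff (fun x => c * (legendre (2 * j)).eval x) m = 2 * (-1) ^ j * c * sphBesselJ (2 * j) m := by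
  unfold fourierCosCoeff
  have h := integral_cos_mul_legendre_two_mul j m
  calc ∫ x in (-1 : ℝ)..1, c * (legendre (2 * j)).eval x * Real.cos (m * x)
      = c * ∫ x in (-1 : ℝ)..1, Real.cos (m * x) * (legendre (2 * j)).eval x := by
        rw [← intervalIntegral.integral_const_mul]
        refine intervalIntegral.integral_congr fun x _ => ?_
        ring
    _ = 2 * (-1) ^ j * c * sphBesselJ (2 * j) m := by rw [h]; ring

/-- The single-term case of (2.10.5.12), PROVED: for `f = c P_{2j+1}`, `S(m) = 2 (-1)ʲ c j_{2j+1}(m)`.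
[cite: DavisRabinowitz1984, Sect. 2.10.5 (2.10.5.12)] -/
theorem fourierSinCoeff_legendre_two_mul_add_one (c : ℝ) (j : ℕ) (m : ℝ) :
    fourierSinCoeff (fun x => c * (legendre (2 * j + 1)).eval x) m =
      2 * (-1) ^ j * c * sphBesselJ (2 * j + 1) m := by
  unfold fourierSinCoeff
  have h := integral_sin_mul_legendre_two_mul_add_one j m
  calc ∫ x in (-1 : ℝ)..1, c * (legendre (2 * j + 1)).eval x * Real.sin (m * x)
      = c * ∫ x in (-1 : ℝ)..1, Real.sin (m * x) * (legendre (2 * j + 1)).eval x := by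
        rw [← intervalIntegral.integral_const_mul]
        refine intervalIntegral.integral_congr fun x _ => ?_
        ring
    _ = 2 * (-1) ^ j * c * sphBesselJ (2 * j + 1) m := by rw [h]; ring

/-! ## Proof of the Bessel evaluations (2.10.5.1)–(2.10.5.2)
(`ChebSinMomentBessel_holds`, `ChebCosMomentBessel_holds`)

The substitution `x = cos θ` (change of variables for the injective `C¹` map `cos` on `(0, π)`, valid for the
singular weight `(1-x²)^{-1/2}`: `MeasureTheory.integral_image_eq_integral_abs_deriv_smul`) and
`T_n(cos θ) = cos nθ` turn the moments into `∫_0^π cos(m cos θ) cos 2kθ dθ`, `∫_0^π sin(m cos θ) cos(2k+1)θ dθ`;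
Bessel's integral `π J_n(m) = ∫_0^π cos(nθ - m sin θ) dθ` (the tree's `besselJ_eq_integral_cos_holds`,
imported from `BesselJAnalyticProofs`) and the reflections `θ ↦ π - θ`, `θ ↦ π/2 - θ` do the rest.
-/

section ChebMomentBesselProof

open Literature.Analysis.FunctionSpaces (besselJ besselJ_eq_integral_cos_holds)

/-- `T_n(cos θ) = cos nθ` over `ℝ` (Mathlib has the complex form `Polynomial.Chebyshev.T_complex_cos`).
[folklore] -/
private theorem chebyshev_T_eval_cos (n : ℕ) (θ : ℝ) :
    (Polynomial.Chebyshev.T ℝ (n : ℤ)).eval (Real.cos θ) = Real.cos (n * θ) := by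
  have h := Polynomial.Chebyshev.T_complex_cos (θ := (θ : ℂ)) (n : ℤ)
  have h2 := Polynomial.Chebyshev.complex_ofReal_eval_T (Real.cos θ) (n : ℤ)
  rw [Complex.ofReal_cos, h] at h2
  have h3 : ((Real.cos (n * θ) : ℝ) : ℂ) = Complex.cos ((n : ℤ) * (θ : ℂ)) := by push_cast; rfl
  rw [← h3] at h2
  exact_mod_cast h2

/-- `cos` maps `(0, π)` onto `(-1, 1)`. [folklore] -/
private theorem image_cos_Ioo : Real.cos '' Ioo (0 : ℝ) Real.pi = Ioo (-1) 1 := by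
  ext y
  constructor
  · rintro ⟨θ, hθ, rfl⟩
    refine ⟨?_, ?_⟩
    · have h := Real.strictAntiOn_cos ⟨hθ.1.le, hθ.2.le⟩ ⟨Real.pi_pos.le, le_rfl⟩ hθ.2
      rwa [Real.cos_pi] at h
    · have h := Real.strictAntiOn_cos ⟨le_rfl, Real.pi_pos.le⟩ ⟨hθ.1.le, hθ.2.le⟩ hθ.1
      rwa [Real.cos_zero] at h
  · rintro ⟨hy1, hy2⟩
    exact ⟨Real.arccos y, ⟨Real.arccos_pos.2 hy2, Real.arccos_lt_pi.2 hy1⟩, Real.cos_arccos hy1.le hy2.le⟩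

/-- The substitution `x = cos θ` for an arbitrary (possibly singular at `±1`) integrand:
`∫_{-1}^{1} g(x) dx = ∫_{(0,π)} sin θ g(cos θ) dθ` (change of variables for the injective `C¹` map `cos` on
the open interval; both sides take the same junk value if `g` is not integrable). [folklore] -/
private theorem integral_comp_cos_Ioo (g : ℝ → ℝ) :
    ∫ x in (-1 : ℝ)..1, g x = ∫ θ in Ioo (0 : ℝ) Real.pi, Real.sin θ * g (Real.cos θ) := by
  have hderiv : ∀ θ ∈ Ioo (0 : ℝ) Real.pi, HasDerivWithinAt Real.cos (-Real.sin θ) (Ioo 0 Real.pi) θ :=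
    fun θ _ => (Real.hasDerivAt_cos θ).hasDerivWithinAt
  have hinj : InjOn Real.cos (Ioo (0 : ℝ) Real.pi) := Real.injOn_cos.mono Ioo_subset_Icc_self
  have h := integral_image_eq_integral_abs_deriv_smul measurableSet_Ioo hderiv hinj g
  rw [image_cos_Ioo] at h
  rw [intervalIntegral.integral_of_le (by norm_num), integral_Ioc_eq_integral_Ioo, h]
  refine setIntegral_congr_fun measurableSet_Ioo fun θ hθ => ?_
  rw [abs_neg, abs_of_pos (Real.sin_pos_of_pos_of_lt_pi hθ.1 hθ.2), smul_eq_mul]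

/-- The weighted Chebyshev moments in trigonometric form:
`∫_{-1}^{1} w(mx) T_n(x) (1-x²)^{-1/2} dx = ∫_0^π w(m cos θ) cos nθ dθ` for any `w`. [folklore] -/
private theorem chebMoment_eq_integral (w : ℝ → ℝ) (m : ℝ) (n : ℕ) :
    ∫ x in (-1 : ℝ)..1, w (m * x) * (Polynomial.Chebyshev.T ℝ (n : ℤ)).eval x / Real.sqrt (1 - x ^ 2) =
      ∫ θ in (0 : ℝ)..Real.pi, w (m * Real.cos θ) * Real.cos (n * θ) := by
  rw [integral_comp_cos_Ioo, intervalIntegral.integral_of_le Real.pi_pos.le, integral_Ioc_eq_integral_Ioo]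
  refine setIntegral_congr_fun measurableSet_Ioo fun θ hθ => ?_
  have hsin : 0 < Real.sin θ := Real.sin_pos_of_pos_of_lt_pi hθ.1 hθ.2
  rw [chebyshev_T_eval_cos, show (1 : ℝ) - Real.cos θ ^ 2 = Real.sin θ ^ 2 by rw [Real.sin_sq],
    Real.sqrt_sq hsin.le]
  field_simp

/-- Symmetry about `π/2`: if `f(π - θ) = -f(θ)` then `∫_0^π f = 0`. [folklore] -/
private theorem integral_zero_pi_eq_zero_of_antisymm {f : ℝ → ℝ} (hf : ∀ θ, f (Real.pi - θ) = -f θ) :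
    ∫ θ in (0 : ℝ)..Real.pi, f θ = 0 := by
  have h1 : ∫ θ in (0 : ℝ)..Real.pi, f (Real.pi - θ) = ∫ θ in (0 : ℝ)..Real.pi, f θ := by
    rw [intervalIntegral.integral_comp_sub_left (fun θ => f θ) Real.pi]
    simp
  have h2 : ∫ θ in (0 : ℝ)..Real.pi, f (Real.pi - θ) = -∫ θ in (0 : ℝ)..Real.pi, f θ := by
    simp only [hf, intervalIntegral.integral_neg]
  linarith

/-- Symmetry about `π/2`: if `f(π - θ) = f(θ)` (and `f` is continuous) then `∫_0^π f = 2 ∫_0^{π/2} f`.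
[folklore] -/
private theorem integral_zero_pi_eq_two_mul_of_symm {f : ℝ → ℝ} (hfc : Continuous f)
    (hf : ∀ θ, f (Real.pi - θ) = f θ) :
    ∫ θ in (0 : ℝ)..Real.pi, f θ = 2 * ∫ θ in (0 : ℝ)..(Real.pi / 2), f θ := by
  have hsplit := intervalIntegral.integral_add_adjacent_intervals (μ := volume)
    (hfc.intervalIntegrable 0 (Real.pi / 2)) (hfc.intervalIntegrable (Real.pi / 2) Real.pi)
  have h2 : ∫ θ in (Real.pi / 2)..Real.pi, f θ = ∫ θ in (0 : ℝ)..(Real.pi / 2), f θ := by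
    have h := intervalIntegral.integral_comp_sub_left (fun θ => f θ) Real.pi (a := 0) (b := Real.pi / 2)
    simp only [hf, sub_zero, show Real.pi - Real.pi / 2 = Real.pi / 2 by ring] at h
    rw [← h]
  rw [← hsplit, h2]
  ring

/-- The reflection `θ ↦ π/2 - θ` on `[0, π/2]`. [folklore] -/
private theorem integral_comp_pi_div_two_sub (f : ℝ → ℝ) :
    ∫ θ in (0 : ℝ)..(Real.pi / 2), f (Real.pi / 2 - θ) = ∫ θ in (0 : ℝ)..(Real.pi / 2), f θ := by
  rw [intervalIntegral.integral_comp_sub_left (fun θ => f θ) (Real.pi / 2)]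
  simp

/-- Bessel's integral with the cosine expanded:
`π J_n(m) = ∫_0^π cos nθ cos(m sin θ) dθ + ∫_0^π sin nθ sin(m sin θ) dθ`. [folklore] -/
private theorem pi_mul_besselJ_eq (n : ℕ) (m : ℝ) :
    Real.pi * besselJ n m = (∫ θ in (0 : ℝ)..Real.pi, Real.cos (n * θ) * Real.cos (m * Real.sin θ)) +
      ∫ θ in (0 : ℝ)..Real.pi, Real.sin (n * θ) * Real.sin (m * Real.sin θ) := by
  rw [besselJ_eq_integral_cos_holds n m, ← mul_assoc, mul_inv_cancel₀ Real.pi_ne_zero, one_mul,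
    ← intervalIntegral.integral_add ((by fun_prop : Continuous fun θ : ℝ =>
      Real.cos (n * θ) * Real.cos (m * Real.sin θ)).intervalIntegrable _ _)
      ((by fun_prop : Continuous fun θ : ℝ => Real.sin (n * θ) * Real.sin (m * Real.sin θ)).intervalIntegrable _ _)]
  refine intervalIntegral.integral_congr fun θ _ => ?_
  simp only [Real.cos_sub]

/-- **(2.10.5.2), even case, PROVED** (discharge of the named fact `ChebCosMomentBessel`):
`∫_{-1}^{1} cos mx T_{2k}(x) (1-x²)^{-1/2} dx = (-1)^k π J_{2k}(m)`. Proof: `x = cos θ` turns the moment into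
`∫_0^π cos(m cos θ) cos 2kθ dθ`; Bessel's integral (the tree's `besselJ_eq_integral_cos_holds`) gives
`π J_{2k}(m) = ∫_0^π cos 2kθ cos(m sin θ) dθ` (the `sin 2kθ sin(m sin θ)` part is odd about `π/2`), and the
reflections `θ ↦ π - θ`, `θ ↦ π/2 - θ` exchange `cos(m sin θ)` and `cos(m cos θ)` at the price `(-1)^k`.
[cite: DavisRabinowitz1984, Sect. 2.10.5 (2.10.5.2)] -/
theorem ChebCosMomentBessel_holds : ∀ (m : ℝ) (k : ℕ), ChebCosMomentBessel m k := by
  intro m k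
  unfold ChebCosMomentBessel chebCosMoment
  rw [chebMoment_eq_integral Real.cos m (2 * k)]
  -- `A = ∫_0^π cos(m cos θ) cos 2kθ = 2 ∫_0^{π/2}`
  have hA := integral_zero_pi_eq_two_mul_of_symm
    (f := fun θ => Real.cos (m * Real.cos θ) * Real.cos ((2 * k : ℕ) * θ)) (by fun_prop) (fun θ => by
      simp only [Real.cos_pi_sub, mul_neg, Real.cos_neg]
      rw [mul_sub, show ((2 * k : ℕ) : ℝ) * Real.pi = ((2 * k : ℕ) : ℕ) * Real.pi by rfl, Real.cos_nat_mul_pi_sub]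
      rw [show ((-1 : ℝ)) ^ (2 * k) = 1 by rw [pow_mul]; norm_num, one_mul])
  -- Bessel side
  have hB := pi_mul_besselJ_eq (2 * k) m
  have hB0 : ∫ θ in (0 : ℝ)..Real.pi, Real.sin ((2 * k : ℕ) * θ) * Real.sin (m * Real.sin θ) = 0 :=
    integral_zero_pi_eq_zero_of_antisymm fun θ => by
      simp only [Real.sin_pi_sub]
      rw [mul_sub, Real.sin_nat_mul_pi_sub, show ((-1 : ℝ)) ^ (2 * k) = 1 by rw [pow_mul]; norm_num, one_mul,
        neg_mul]
  have hB1 := integral_zero_pi_eq_two_mul_of_symm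
    (f := fun θ => Real.cos ((2 * k : ℕ) * θ) * Real.cos (m * Real.sin θ)) (by fun_prop) (fun θ => by
      simp only [Real.sin_pi_sub]
      rw [mul_sub, Real.cos_nat_mul_pi_sub, show ((-1 : ℝ)) ^ (2 * k) = 1 by rw [pow_mul]; norm_num, one_mul])
  -- the reflection `θ ↦ π/2 - θ` on `[0, π/2]`
  have hR : ∫ θ in (0 : ℝ)..(Real.pi / 2), Real.cos ((2 * k : ℕ) * θ) * Real.cos (m * Real.sin θ) =
      (-1) ^ k * ∫ θ in (0 : ℝ)..(Real.pi / 2), Real.cos (m * Real.cos θ) * Real.cos ((2 * k : ℕ) * θ) := by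
    rw [← integral_comp_pi_div_two_sub (fun θ => Real.cos ((2 * k : ℕ) * θ) * Real.cos (m * Real.sin θ)),
      ← intervalIntegral.integral_const_mul]
    refine intervalIntegral.integral_congr fun θ _ => ?_
    simp only [Real.sin_pi_div_two_sub]
    rw [mul_sub, show ((2 * k : ℕ) : ℝ) * (Real.pi / 2) = (k : ℕ) * Real.pi by push_cast; ring,
      Real.cos_nat_mul_pi_sub]
    ring
  rw [hA]
  have : Real.pi * besselJ (2 * k) m = (-1) ^ k * (2 * ∫ θ in (0 : ℝ)..(Real.pi / 2),
      Real.cos (m * Real.cos θ) * Real.cos ((2 * k : ℕ) * θ)) := by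
    rw [hB, hB0, add_zero, hB1, hR]; ring
  have h1 : ((-1 : ℝ) ^ k) * (-1) ^ k = 1 := by rw [← pow_add, ← two_mul, pow_mul]; norm_num
  calc (2 * ∫ θ in (0 : ℝ)..(Real.pi / 2), Real.cos (m * Real.cos θ) * Real.cos ((2 * k : ℕ) * θ))
      = ((-1 : ℝ) ^ k * (-1) ^ k) * (2 * ∫ θ in (0 : ℝ)..(Real.pi / 2),
          Real.cos (m * Real.cos θ) * Real.cos ((2 * k : ℕ) * θ)) := by rw [h1, one_mul]
    _ = (-1) ^ k * Real.pi * besselJ (2 * k) m := by rw [mul_assoc ((-1 : ℝ) ^ k) Real.pi, this]; ring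

/-- **(2.10.5.1), odd case, PROVED** (discharge of the named fact `ChebSinMomentBessel`):
`∫_{-1}^{1} sin mx T_{2k+1}(x) (1-x²)^{-1/2} dx = (-1)^k π J_{2k+1}(m)`, by the same substitution and
reflections (now the `cos(2k+1)θ cos(m sin θ)` part of Bessel's integral is odd about `π/2`, and
`sin((2k+1)(π/2 - θ)) = (-1)^k cos((2k+1)θ)`). [cite: DavisRabinowitz1984, Sect. 2.10.5 (2.10.5.1)] -/
theorem ChebSinMomentBessel_holds : ∀ (m : ℝ) (k : ℕ), ChebSinMomentBessel m k := by
  intro m k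
  unfold ChebSinMomentBessel chebSinMoment
  rw [chebMoment_eq_integral Real.sin m (2 * k + 1)]
  have hodd : ((-1 : ℝ)) ^ (2 * k + 1) = -1 := by rw [pow_succ, pow_mul]; norm_num
  -- `A' = ∫_0^π sin(m cos θ) cos(2k+1)θ = 2 ∫_0^{π/2}`
  have hA := integral_zero_pi_eq_two_mul_of_symm
    (f := fun θ => Real.sin (m * Real.cos θ) * Real.cos ((2 * k + 1 : ℕ) * θ)) (by fun_prop) (fun θ => by
      simp only [Real.cos_pi_sub, mul_neg, Real.sin_neg]
      rw [mul_sub, Real.cos_nat_mul_pi_sub, hodd]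
      ring)
  have hB := pi_mul_besselJ_eq (2 * k + 1) m
  have hB0 : ∫ θ in (0 : ℝ)..Real.pi, Real.cos ((2 * k + 1 : ℕ) * θ) * Real.cos (m * Real.sin θ) = 0 :=
    integral_zero_pi_eq_zero_of_antisymm fun θ => by
      simp only [Real.sin_pi_sub]
      rw [mul_sub, Real.cos_nat_mul_pi_sub, hodd]
      ring
  have hB1 := integral_zero_pi_eq_two_mul_of_symm
    (f := fun θ => Real.sin ((2 * k + 1 : ℕ) * θ) * Real.sin (m * Real.sin θ)) (by fun_prop) (fun θ => by
      simp only [Real.sin_pi_sub]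
      rw [mul_sub, Real.sin_nat_mul_pi_sub, hodd]
      ring)
  have hR : ∫ θ in (0 : ℝ)..(Real.pi / 2), Real.sin ((2 * k + 1 : ℕ) * θ) * Real.sin (m * Real.sin θ) =
      (-1) ^ k * ∫ θ in (0 : ℝ)..(Real.pi / 2), Real.sin (m * Real.cos θ) * Real.cos ((2 * k + 1 : ℕ) * θ) := by
    rw [← integral_comp_pi_div_two_sub (fun θ => Real.sin ((2 * k + 1 : ℕ) * θ) * Real.sin (m * Real.sin θ)),
      ← intervalIntegral.integral_const_mul]
    refine intervalIntegral.integral_congr fun θ _ => ?_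
    simp only [Real.sin_pi_div_two_sub]
    rw [mul_sub, show ((2 * k + 1 : ℕ) : ℝ) * (Real.pi / 2) = (Real.pi / 2 - (2 * k + 1 : ℕ) * θ + (k : ℕ) * Real.pi)
        + (2 * k + 1 : ℕ) * θ by push_cast; ring, add_sub_cancel_right, Real.sin_add_nat_mul_pi,
      Real.sin_pi_div_two_sub]
    ring
  rw [hA]
  have : Real.pi * besselJ (2 * k + 1) m = (-1) ^ k * (2 * ∫ θ in (0 : ℝ)..(Real.pi / 2),
      Real.sin (m * Real.cos θ) * Real.cos ((2 * k + 1 : ℕ) * θ)) := by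
    rw [hB, hB0, zero_add, hB1, hR]; ring
  have h1 : ((-1 : ℝ) ^ k) * (-1) ^ k = 1 := by rw [← pow_add, ← two_mul, pow_mul]; norm_num
  calc (2 * ∫ θ in (0 : ℝ)..(Real.pi / 2), Real.sin (m * Real.cos θ) * Real.cos ((2 * k + 1 : ℕ) * θ))
      = ((-1 : ℝ) ^ k * (-1) ^ k) * (2 * ∫ θ in (0 : ℝ)..(Real.pi / 2),
          Real.sin (m * Real.cos θ) * Real.cos ((2 * k + 1 : ℕ) * θ)) := by rw [h1, one_mul]
    _ = (-1) ^ k * Real.pi * besselJ (2 * k + 1) m := by rw [mul_assoc ((-1 : ℝ) ^ k) Real.pi, this]; ring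

end ChebMomentBesselProof

/-! ## Proof of the expansions (2.10.5.4)–(2.10.5.5) and (2.10.5.12)–(2.10.5.13)
(`PiessensPoleunisSin_holds`, `PiessensPoleunisCos_holds`, `BakhvalovVasilevaSin_holds`, `BakhvalovVasilevaCos_holds`)

Termwise integration (`MeasureTheory.integral_tsum_of_summable_integral_norm`): the terms are dominated by
`|C_n| (1-x²)^{-1/2}` (`|T_n| ≤ 1`, the weight being integrable on `(-1, 1)` as the derivative of `arcsin`),
resp. by `|c_k|` (`|P_k| ≤ 1`, the tree's `abs_eval_legendre_le_one`), and the termwise integrals are the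
moments (2.10.5.1)–(2.10.5.2) proved above, resp. the Legendre moments proved from (2.10.5.11); splitting the
resulting series into even and odd indices gives the printed Bessel series.
-/

section FourierSeriesExpansionsProof

open Literature.Analysis.FunctionSpaces (besselJ)
open Literature.Analysis.SpecialFunctions (legendre sphBesselJ abs_eval_legendre_le_one)

/-- The Chebyshev weight `(1-x²)^{-1/2}` is integrable on `(-1, 1)` (it is the derivative of `arcsin`).
[folklore] -/
private theorem integrableOn_inv_sqrt_one_sub_sq :
    IntegrableOn (fun x : ℝ => 1 / Real.sqrt (1 - x ^ 2)) (Ioo (-1) 1) := by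
  have h := intervalIntegral.integrableOn_deriv_of_nonneg (a := (-1 : ℝ)) (b := 1)
    Real.continuous_arcsin.continuousOn
    (fun x hx => Real.hasDerivAt_arcsin (ne_of_gt hx.1) (ne_of_lt hx.2)) (fun x _ => by positivity)
  exact h.mono_set Ioo_subset_Ioc_self

/-- `|T_n(x)| ≤ 1` for `x ∈ (-1, 1)` (`x = cos θ`, `T_n(cos θ) = cos nθ`). [folklore] -/
private theorem abs_chebyshev_T_le_one (n : ℕ) {x : ℝ} (hx : x ∈ Ioo (-1 : ℝ) 1) :
    |(Polynomial.Chebyshev.T ℝ (n : ℤ)).eval x| ≤ 1 := by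
  rw [← Real.cos_arccos hx.1.le hx.2.le, chebyshev_T_eval_cos]
  exact Real.abs_cos_le_one _

/-- `∫_{-1}^{1} = ∫_{(-1,1)}`. [folklore] -/
private theorem intervalIntegral_eq_integral_Ioo (g : ℝ → ℝ) :
    ∫ x in (-1 : ℝ)..1, g x = ∫ x in Ioo (-1 : ℝ) 1, g x := by
  rw [intervalIntegral.integral_of_le (by norm_num), integral_Ioc_eq_integral_Ioo]

/-- The weighted Chebyshev moments are bounded by `∫_{(-1,1)} (1-x²)^{-1/2} dx` when `|w| ≤ 1`. [folklore] -/
private theorem abs_chebMoment_le {w : ℝ → ℝ} (hw1 : ∀ x, |w x| ≤ 1) (n : ℕ) :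
    |∫ x in (-1 : ℝ)..1, w x * (Polynomial.Chebyshev.T ℝ (n : ℤ)).eval x / Real.sqrt (1 - x ^ 2)| ≤
      ∫ x in Ioo (-1 : ℝ) 1, 1 / Real.sqrt (1 - x ^ 2) := by
  rw [intervalIntegral_eq_integral_Ioo, ← Real.norm_eq_abs]
  refine norm_integral_le_of_norm_le integrableOn_inv_sqrt_one_sub_sq
    ((ae_restrict_iff' measurableSet_Ioo).2 (Filter.Eventually.of_forall fun x hx => ?_))
  have hpos : 0 < Real.sqrt (1 - x ^ 2) := Real.sqrt_pos.2 (by nlinarith [hx.1, hx.2])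
  rw [Real.norm_eq_abs, abs_div, abs_mul, abs_of_pos hpos, div_le_div_iff_of_pos_right hpos]
  calc |w x| * |(Polynomial.Chebyshev.T ℝ (n : ℤ)).eval x| ≤ 1 * 1 :=
      mul_le_mul (hw1 x) (abs_chebyshev_T_le_one n hx) (abs_nonneg _) zero_le_one
    _ = 1 := one_mul 1

/-- Termwise integration of a Chebyshev expansion against the singular weight: if `Σ |C_n| < ∞` and
`Σ C_n T_n(x) = (1-x²)^{1/2} f(x)` on `(-1, 1)`, then for any continuous `w` with `|w| ≤ 1`,
`∫_{-1}^{1} f(x) w(x) dx = Σ_n C_n ∫_{-1}^{1} w(x) T_n(x) (1-x²)^{-1/2} dx` (dominated convergence,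
`|T_n| ≤ 1`, the weight being integrable). [folklore] -/
private theorem integral_eq_tsum_chebMoment {f : ℝ → ℝ} {C : ℕ → ℝ} (hC : Summable fun n => |C n|)
    (hf : ∀ x ∈ Ioo (-1 : ℝ) 1,
      HasSum (fun n => C n * (Polynomial.Chebyshev.T ℝ n).eval x) (Real.sqrt (1 - x ^ 2) * f x))
    {w : ℝ → ℝ} (hw : Continuous w) (hw1 : ∀ x, |w x| ≤ 1) :
    ∫ x in (-1 : ℝ)..1, f x * w x =
      ∑' n : ℕ, C n *
        ∫ x in (-1 : ℝ)..1, w x * (Polynomial.Chebyshev.T ℝ (n : ℤ)).eval x / Real.sqrt (1 - x ^ 2) := by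
  set F : ℕ → ℝ → ℝ := fun n x =>
    C n * (w x * (Polynomial.Chebyshev.T ℝ (n : ℤ)).eval x / Real.sqrt (1 - x ^ 2)) with hF
  -- integrability and the norm bound of each term
  have hcont : ∀ n, ContinuousOn (F n) (Ioo (-1 : ℝ) 1) := by
    intro n
    refine continuousOn_const.mul ((hw.continuousOn.mul (Polynomial.continuous _).continuousOn).div
      (Real.continuous_sqrt.comp (by fun_prop)).continuousOn fun x hx => ?_)
    have : 0 < 1 - x ^ 2 := by nlinarith [hx.1, hx.2]
    exact (Real.sqrt_pos.2 this).ne'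
  have hbound : ∀ n, ∀ x ∈ Ioo (-1 : ℝ) 1, ‖F n x‖ ≤ |C n| * (1 / Real.sqrt (1 - x ^ 2)) := by
    intro n x hx
    have hpos : 0 < Real.sqrt (1 - x ^ 2) := Real.sqrt_pos.2 (by nlinarith [hx.1, hx.2])
    rw [hF, Real.norm_eq_abs, abs_mul, abs_div, abs_mul, abs_of_pos hpos]
    refine mul_le_mul_of_nonneg_left ?_ (abs_nonneg _)
    rw [div_le_div_iff_of_pos_right hpos]
    calc |w x| * |(Polynomial.Chebyshev.T ℝ (n : ℤ)).eval x| ≤ 1 * 1 :=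
        mul_le_mul (hw1 x) (abs_chebyshev_T_le_one n hx) (abs_nonneg _) zero_le_one
      _ = 1 := one_mul 1
  have hint : ∀ n, IntegrableOn (F n) (Ioo (-1 : ℝ) 1) := fun n =>
    (integrableOn_inv_sqrt_one_sub_sq.const_mul (|C n|)).mono' ((hcont n).aestronglyMeasurable measurableSet_Ioo)
      ((ae_restrict_iff' measurableSet_Ioo).2 (Filter.Eventually.of_forall (hbound n)))
  have hsum : Summable fun n => ∫ x in Ioo (-1 : ℝ) 1, ‖F n x‖ := by
    refine Summable.of_nonneg_of_le (fun n => integral_nonneg fun x => norm_nonneg _) (fun n => ?_)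
      (hC.mul_right (∫ x in Ioo (-1 : ℝ) 1, 1 / Real.sqrt (1 - x ^ 2)))
    rw [← MeasureTheory.integral_const_mul]
    exact setIntegral_mono_on (hint n).norm (integrableOn_inv_sqrt_one_sub_sq.const_mul _)
      measurableSet_Ioo (hbound n)
  -- the pointwise sum
  have hpt : ∀ x ∈ Ioo (-1 : ℝ) 1, f x * w x = ∑' n, F n x := by
    intro x hx
    have hpos : 0 < Real.sqrt (1 - x ^ 2) := Real.sqrt_pos.2 (by nlinarith [hx.1, hx.2])
    have h := (hf x hx).mul_right (w x / Real.sqrt (1 - x ^ 2))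
    have hval : Real.sqrt (1 - x ^ 2) * f x * (w x / Real.sqrt (1 - x ^ 2)) = f x * w x := by
      field_simp
    rw [hval] at h
    have h' : HasSum (fun n => F n x) (f x * w x) := h.congr_fun fun n => by simp only [hF]; ring
    exact h'.tsum_eq.symm
  rw [intervalIntegral_eq_integral_Ioo, setIntegral_congr_fun measurableSet_Ioo hpt,
    ← integral_tsum_of_summable_integral_norm hint hsum]
  refine tsum_congr fun n => ?_
  rw [intervalIntegral_eq_integral_Ioo, ← MeasureTheory.integral_const_mul]

/-- Termwise integration of an absolutely summable Legendre expansion (`|P_k| ≤ 1` on `[-1, 1]`): if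
`f = Σ c_k P_k` on `(-1, 1)` with `Σ |c_k| < ∞`, then for continuous `w` with `|w| ≤ 1`,
`∫_{-1}^{1} f(x) w(x) dx = Σ_k c_k ∫_{-1}^{1} w(x) P_k(x) dx`. [folklore] -/
private theorem integral_eq_tsum_legendre {f : ℝ → ℝ} {c : ℕ → ℝ} (hc : Summable fun k => |c k|)
    (hf : ∀ x ∈ Ioo (-1 : ℝ) 1, HasSum (fun k => c k * (legendre k).eval x) (f x))
    {w : ℝ → ℝ} (hw : Continuous w) (hw1 : ∀ x, |w x| ≤ 1) :
    ∫ x in (-1 : ℝ)..1, f x * w x = ∑' k : ℕ, c k * ∫ x in (-1 : ℝ)..1, w x * (legendre k).eval x := by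
  set F : ℕ → ℝ → ℝ := fun k x => c k * (w x * (legendre k).eval x) with hF
  have hcont : ∀ k, Continuous (F k) := fun k => by simp only [hF]; fun_prop
  have hbound : ∀ k, ∀ x ∈ Ioo (-1 : ℝ) 1, ‖F k x‖ ≤ |c k| := by
    intro k x hx
    rw [hF, Real.norm_eq_abs, abs_mul, abs_mul]
    refine mul_le_of_le_one_right (abs_nonneg _) ?_
    calc |w x| * |(legendre k).eval x| ≤ 1 * 1 :=
        mul_le_mul (hw1 x) (abs_eval_legendre_le_one k (abs_le.2 ⟨hx.1.le, hx.2.le⟩)) (abs_nonneg _)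
          zero_le_one
      _ = 1 := one_mul 1
  have hint : ∀ k, IntegrableOn (F k) (Ioo (-1 : ℝ) 1) := fun k =>
    (hcont k).integrableOn_Icc.mono_set Ioo_subset_Icc_self
  have hvol : volume.real (Ioo (-1 : ℝ) 1) = 2 := by rw [measureReal_def, Real.volume_Ioo]; norm_num
  have hsum : Summable fun k => ∫ x in Ioo (-1 : ℝ) 1, ‖F k x‖ := by
    refine Summable.of_nonneg_of_le (fun k => integral_nonneg fun x => norm_nonneg _) (fun k => ?_)
      (hc.mul_right 2)
    have h := setIntegral_mono_on (hint k).norm (integrableOn_const (C := |c k|) (by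
        rw [Real.volume_Ioo]; exact ENNReal.ofReal_ne_top)) measurableSet_Ioo (hbound k)
    rw [setIntegral_const, hvol, smul_eq_mul] at h
    linarith
  have hpt : ∀ x ∈ Ioo (-1 : ℝ) 1, f x * w x = ∑' k, F k x := by
    intro x hx
    have h := (hf x hx).mul_right (w x)
    have h' : HasSum (fun k => F k x) (f x * w x) := h.congr_fun fun k => by simp only [hF]; ring
    exact h'.tsum_eq.symm
  rw [intervalIntegral_eq_integral_Ioo, setIntegral_congr_fun measurableSet_Ioo hpt,
    ← integral_tsum_of_summable_integral_norm hint hsum]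
  refine tsum_congr fun k => ?_
  rw [intervalIntegral_eq_integral_Ioo, ← MeasureTheory.integral_const_mul]

/-- `|∫_{-1}^{1} w P_k| ≤ 2` for `|w| ≤ 1`. [folklore] -/
private theorem abs_integral_mul_legendre_le {w : ℝ → ℝ} (hw1 : ∀ x, |w x| ≤ 1) (k : ℕ) :
    |∫ x in (-1 : ℝ)..1, w x * (legendre k).eval x| ≤ 2 := by
  have h := intervalIntegral.norm_integral_le_of_norm_le_const (a := (-1 : ℝ)) (b := 1) (C := 1)
    (f := fun x => w x * (legendre k).eval x) fun x hx => by
      rw [uIoc_of_le (by norm_num)] at hx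
      rw [norm_mul, Real.norm_eq_abs, Real.norm_eq_abs]
      calc |w x| * |(legendre k).eval x| ≤ 1 * 1 :=
          mul_le_mul (hw1 x) (abs_eval_legendre_le_one k (abs_le.2 ⟨hx.1.le, hx.2⟩)) (abs_nonneg _)
            zero_le_one
        _ = 1 := one_mul 1
  rw [Real.norm_eq_abs] at h
  refine h.trans ?_
  norm_num

/-- `k ↦ 2k` is injective. [folklore] -/
private theorem injective_two_mul : Function.Injective fun k : ℕ => 2 * k := fun a b h => by
  simp only at h; omega

/-- `k ↦ 2k+1` is injective. [folklore] -/
private theorem injective_two_mul_add_one : Function.Injective fun k : ℕ => 2 * k + 1 := fun a b h => by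
  simp only at h; omega

/-- **(2.10.5.4), PROVED** (discharge of the named fact `PiessensPoleunisSin`): for
`(1-x²)^{1/2} f = Σ C_n T_n` with `Σ |C_n| < ∞`, `S(m) = π Σ_k C_{2k+1} (-1)^k J_{2k+1}(m)` — termwise integration
(`|T_n| ≤ 1`, integrable weight) and the moments (2.10.5.1) (`chebSinMoment_two_mul`,
`ChebSinMomentBessel_holds`). [cite: DavisRabinowitz1984, Sect. 2.10.5 (2.10.5.4)] -/
theorem PiessensPoleunisSin_holds : ∀ (f : ℝ → ℝ) (C : ℕ → ℝ) (m : ℝ), PiessensPoleunisSin f C m := by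
  intro f C m hC hf
  unfold fourierSinCoeff piessensSinSeries
  have h := integral_eq_tsum_chebMoment hC hf (w := fun x => Real.sin (m * x)) (by fun_prop)
    (fun x => Real.abs_sin_le_one _)
  rw [h]
  have hmom : ∀ n : ℕ, ∫ x in (-1 : ℝ)..1, Real.sin (m * x) * (Polynomial.Chebyshev.T ℝ (n : ℤ)).eval x /
      Real.sqrt (1 - x ^ 2) = chebSinMoment m n := fun n => rfl
  simp only [hmom]
  -- summability of the term sequence and its even/odd parts
  have hbd : ∀ n, ‖C n * chebSinMoment m n‖ ≤ |C n| * (∫ x in Ioo (-1 : ℝ) 1, 1 / Real.sqrt (1 - x ^ 2)) :=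
      fun n => by
    rw [norm_mul, Real.norm_eq_abs, Real.norm_eq_abs]
    exact mul_le_mul_of_nonneg_left (abs_chebMoment_le (fun x => Real.abs_sin_le_one _) n)
      (abs_nonneg _)
  have he : Summable fun k => C (2 * k) * chebSinMoment m (2 * k) :=
    .of_norm_bounded ((hC.mul_right _).comp_injective injective_two_mul) fun k => hbd (2 * k)
  have ho : Summable fun k => C (2 * k + 1) * chebSinMoment m (2 * k + 1) :=
    .of_norm_bounded ((hC.mul_right _).comp_injective injective_two_mul_add_one) fun k => hbd (2 * k + 1)
  rw [(tsum_even_add_odd (f := fun n => C n * chebSinMoment m n) he ho).symm]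
  have he0 : ∑' k, C (2 * k) * chebSinMoment m (2 * k) = 0 := by
    rw [show (fun k => C (2 * k) * chebSinMoment m (2 * k)) = fun _ => 0 from
      funext fun k => by rw [chebSinMoment_two_mul, mul_zero], tsum_zero]
  rw [he0, zero_add, ← tsum_mul_left]
  refine tsum_congr fun k => ?_
  have := ChebSinMomentBessel_holds m k
  unfold ChebSinMomentBessel at this
  rw [this]
  ring

/-- **(2.10.5.5), PROVED** (discharge of the named fact `PiessensPoleunisCos`):
`C(m) = π Σ_k C_{2k} (-1)^k J_{2k}(m)` under the same hypotheses.
[cite: DavisRabinowitz1984, Sect. 2.10.5 (2.10.5.5)] -/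
theorem PiessensPoleunisCos_holds : ∀ (f : ℝ → ℝ) (C : ℕ → ℝ) (m : ℝ), PiessensPoleunisCos f C m := by
  intro f C m hC hf
  unfold fourierCosCoeff piessensCosSeries
  have h := integral_eq_tsum_chebMoment hC hf (w := fun x => Real.cos (m * x)) (by fun_prop)
    (fun x => Real.abs_cos_le_one _)
  rw [h]
  have hmom : ∀ n : ℕ, ∫ x in (-1 : ℝ)..1, Real.cos (m * x) * (Polynomial.Chebyshev.T ℝ (n : ℤ)).eval x /
      Real.sqrt (1 - x ^ 2) = chebCosMoment m n := fun n => rfl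
  simp only [hmom]
  have hbd : ∀ n, ‖C n * chebCosMoment m n‖ ≤ |C n| * (∫ x in Ioo (-1 : ℝ) 1, 1 / Real.sqrt (1 - x ^ 2)) :=
      fun n => by
    rw [norm_mul, Real.norm_eq_abs, Real.norm_eq_abs]
    exact mul_le_mul_of_nonneg_left (abs_chebMoment_le (fun x => Real.abs_cos_le_one _) n)
      (abs_nonneg _)
  have he : Summable fun k => C (2 * k) * chebCosMoment m (2 * k) :=
    .of_norm_bounded ((hC.mul_right _).comp_injective injective_two_mul) fun k => hbd (2 * k)
  have ho : Summable fun k => C (2 * k + 1) * chebCosMoment m (2 * k + 1) :=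
    .of_norm_bounded ((hC.mul_right _).comp_injective injective_two_mul_add_one) fun k => hbd (2 * k + 1)
  rw [(tsum_even_add_odd (f := fun n => C n * chebCosMoment m n) he ho).symm]
  have ho0 : ∑' k, C (2 * k + 1) * chebCosMoment m (2 * k + 1) = 0 := by
    rw [show (fun k => C (2 * k + 1) * chebCosMoment m (2 * k + 1)) = fun _ => 0 from
      funext fun k => by rw [chebCosMoment_two_mul_add_one, mul_zero], tsum_zero]
  rw [ho0, add_zero, ← tsum_mul_left]
  refine tsum_congr fun k => ?_
  have := ChebCosMomentBessel_holds m k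
  unfold ChebCosMomentBessel at this
  rw [this]
  ring

/-- **(2.10.5.12), PROVED** (discharge of the named fact `BakhvalovVasilevaSin`): for `f = Σ c_k P_k` with
`Σ |c_k| < ∞`, `S(m) = Σ_j 2 (-1)ʲ c_{2j+1} j_{2j+1}(m)` — termwise integration (`|P_k| ≤ 1`) and the proved
moments `∫ sin mx P_{2j} = 0`, `∫ sin mx P_{2j+1} = 2(-1)ʲ j_{2j+1}(m)`.
[cite: DavisRabinowitz1984, Sect. 2.10.5 (2.10.5.12)] -/
theorem BakhvalovVasilevaSin_holds : ∀ (f : ℝ → ℝ) (c : ℕ → ℝ) (m : ℝ), BakhvalovVasilevaSin f c m := by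
  intro f c m hc hf
  unfold fourierSinCoeff bakhvalovSinSeries
  have h := integral_eq_tsum_legendre hc hf (w := fun x => Real.sin (m * x)) (by fun_prop)
    (fun x => Real.abs_sin_le_one _)
  rw [h]
  have hbd : ∀ k, ‖c k * ∫ x in (-1 : ℝ)..1, Real.sin (m * x) * (legendre k).eval x‖ ≤ |c k| * 2 := fun k => by
    rw [norm_mul, Real.norm_eq_abs, Real.norm_eq_abs]
    exact mul_le_mul_of_nonneg_left (abs_integral_mul_legendre_le (fun x => Real.abs_sin_le_one _) k)
      (abs_nonneg _)
  have he : Summable fun j => c (2 * j) * ∫ x in (-1 : ℝ)..1, Real.sin (m * x) * (legendre (2 * j)).eval x :=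
    .of_norm_bounded ((hc.mul_right 2).comp_injective injective_two_mul) fun j => hbd (2 * j)
  have ho : Summable fun j => c (2 * j + 1) *
      ∫ x in (-1 : ℝ)..1, Real.sin (m * x) * (legendre (2 * j + 1)).eval x :=
    .of_norm_bounded ((hc.mul_right 2).comp_injective injective_two_mul_add_one) fun j => hbd (2 * j + 1)
  rw [(tsum_even_add_odd (f := fun k => c k * ∫ x in (-1 : ℝ)..1, Real.sin (m * x) * (legendre k).eval x)
    he ho).symm]
  have he0 : ∑' j, c (2 * j) * ∫ x in (-1 : ℝ)..1, Real.sin (m * x) * (legendre (2 * j)).eval x = 0 := by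
    rw [show (fun j => c (2 * j) * ∫ x in (-1 : ℝ)..1, Real.sin (m * x) * (legendre (2 * j)).eval x) =
      fun _ => 0 from funext fun j => by rw [integral_sin_mul_legendre_two_mul, mul_zero], tsum_zero]
  rw [he0, zero_add]
  refine tsum_congr fun j => ?_
  rw [integral_sin_mul_legendre_two_mul_add_one]
  ring

/-- **(2.10.5.13), PROVED** (discharge of the named fact `BakhvalovVasilevaCos`):
`C(m) = Σ_j 2 (-1)ʲ c_{2j} j_{2j}(m)` under the same hypotheses.
[cite: DavisRabinowitz1984, Sect. 2.10.5 (2.10.5.13)] -/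
theorem BakhvalovVasilevaCos_holds : ∀ (f : ℝ → ℝ) (c : ℕ → ℝ) (m : ℝ), BakhvalovVasilevaCos f c m := by
  intro f c m hc hf
  unfold fourierCosCoeff bakhvalovCosSeries
  have h := integral_eq_tsum_legendre hc hf (w := fun x => Real.cos (m * x)) (by fun_prop)
    (fun x => Real.abs_cos_le_one _)
  rw [h]
  have hbd : ∀ k, ‖c k * ∫ x in (-1 : ℝ)..1, Real.cos (m * x) * (legendre k).eval x‖ ≤ |c k| * 2 := fun k => by
    rw [norm_mul, Real.norm_eq_abs, Real.norm_eq_abs]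
    exact mul_le_mul_of_nonneg_left (abs_integral_mul_legendre_le (fun x => Real.abs_cos_le_one _) k)
      (abs_nonneg _)
  have he : Summable fun j => c (2 * j) * ∫ x in (-1 : ℝ)..1, Real.cos (m * x) * (legendre (2 * j)).eval x :=
    .of_norm_bounded ((hc.mul_right 2).comp_injective injective_two_mul) fun j => hbd (2 * j)
  have ho : Summable fun j => c (2 * j + 1) *
      ∫ x in (-1 : ℝ)..1, Real.cos (m * x) * (legendre (2 * j + 1)).eval x :=
    .of_norm_bounded ((hc.mul_right 2).comp_injective injective_two_mul_add_one) fun j => hbd (2 * j + 1)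
  rw [(tsum_even_add_odd (f := fun k => c k * ∫ x in (-1 : ℝ)..1, Real.cos (m * x) * (legendre k).eval x)
    he ho).symm]
  have ho0 : ∑' j, c (2 * j + 1) * ∫ x in (-1 : ℝ)..1, Real.cos (m * x) * (legendre (2 * j + 1)).eval x = 0 := by
    rw [show (fun j => c (2 * j + 1) * ∫ x in (-1 : ℝ)..1, Real.cos (m * x) * (legendre (2 * j + 1)).eval x) =
      fun _ => 0 from funext fun j => by rw [integral_cos_mul_legendre_two_mul_add_one, mul_zero], tsum_zero]
  rw [ho0, add_zero]
  refine tsum_congr fun j => ?_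
  rw [integral_cos_mul_legendre_two_mul]
  ring

end FourierSeriesExpansionsProof

end Literature.Analysis.Quadrature
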